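import Summits.ABC.IUTFork.Cor312PinnedFrameFlip
import Summits.ABC.IUTFork.Cor312PinnedCountermodel
import Summits.ABC.IUTFork.Cor312PinnedIdentified
import HarnessLib

/-!
# [IUTchIII] Cor. 3.12 — the FRAME-DEPTH family: PR-2's pinned setting over the TRUNCATED `p`-adic hull frame `{B_0, B_1, …, B_K}`

Record file (D-0012; MODEL DATA + proofs, no `Prop` fact) of the abc-iut cell, IUT REPAIR branch (rung LADDER-ABC:A2.RP; seat abc-iut-rp-m4
gen 2, engine E6 of the seat's row RP-M51 «(C14)/(Lin) non-linearity», `Repair/CandMochizuki41` p440036; flat per RULINGS #14/#19). TAKES NO SIDE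
on [IUTchIII] Cor. 3.12 or on any author; a model of READING PREDICATES is a consistency witness, not an endorsement; toy carriers (one place,
`l⋇ = 2`); typed ≠ proved; instantiated ≠ endorsed.

WHY. abc-iut-w4-d103's frame flip (`Cor312PinnedFrameFlip`, p420622) replaces the natural `p`-adic frame of abc-iut-w4-d101's countermodel CM
by the COARSE frame `{B_0, B_1}`: same regions, same pins, the hull of `B_{j²}` inflates to `B_1`, and the typed Corollary HOLDS. This file
interpolates: the TRUNCATED frame of DEPTH `K ∈ ℕ`, hull-sets `{B_k | 0 ≤ k ≤ K}` ([IUTchIII] `paper:url-4b091feeb646` Rmk. 3.9.5 (i), p. 127: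
the hull is «the smallest subset of the form λ·𝒪 that contains» the region — here the smallest AVAILABLE ball), so that the hull of `B_m`
(`m ≥ 0`) is `B_{min(m, K)}`: `K = 1` is the flip, `K ≥ 4` sees CM's regions exactly (`B_1`, `B_4` are hull-sets), `K = 0` collapses
everything to `𝒪`. One more FRAME axis for the profile (next to the frame flip), on which per-label hull inflation is NOT uniform.
[claim: Mochizuki2012, status: disputed]

RESULTS (ns `Summit.ABC.IUTFork.Cor312Vol.TruncFrame`), for every prime `p` and depth `K`: `truncFrame` (the frame; `truncFrame_hull_pBall`:
`hull B_m = B_{min(m,K)}` for `m ≥ 0`), `truncSetting p K := {pinnedSetting p with frame := truncFrame}`; `trunc_thetaHull` / `trunc_thetaLocal`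
(`−min(j², K)·log p`), `trunc_negLogTheta = −((min(1,K) + min(4,K))/2)·log p`, `trunc_negLogQ = −log p`; **`trunc_statement_iff :
Statement ↔ K ≤ 1`**; `trunc_bridgeHyps`, `trunc_absLogQPos`, the THREE PINS `trunc_pinnedRegions3` (CM's operators `orbitRegion`/`qDatum`,
which do not read the frame), `trunc_not_pilotKummerIndRelated` (S FAILS at every depth — CM's regions), typed Thm. 3.11 = abc-iut-w5-d247's
`naiveFull_statement`. Used by `Repair/CandMochizuki41Shift` v2 for the corner «H ∧ ¬Statement» (`K = 2, 3`). Nothing here grades any row.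
-/

noncomputable section

open Set

namespace Summit.ABC.IUTFork.Cor312Vol

namespace TruncFrame

open Thm311 Cor312 Cor312.Checks Cor312.IdentifiedNonVacuity NaiveWitness PinnedWitness PinnedHonest Literature.IUT.LogThetaLattice

variable (p : ℕ) (K : ℕ)

/-! ## 1. The truncated `p`-adic hull frame of depth `K` -/

/-- The hull-sets of depth `K` at a packet: the balls `B_k`, `0 ≤ k ≤ K`. DATA of a toy. [folklore] -/
def truncHul (j : toyIndex.Label) (vQ : toyIndex.VQ) : Set (Set (signShells.Packet j vQ)) :=
  {H | ∃ k : ℤ, 0 ≤ k ∧ k ≤ K ∧ H = pBall p j vQ k}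

/-- `B_k` is a hull-set of depth `K` when `0 ≤ k ≤ K`. [folklore] -/
theorem pBall_mem_truncHul (j : toyIndex.Label) (vQ : toyIndex.VQ) {k : ℤ} (h0 : 0 ≤ k) (hK : k ≤ K) :
    pBall p j vQ k ∈ truncHul p K j vQ := ⟨k, h0, hK, rfl⟩

/-- Every hull-set of depth `K` contains `B_K` and lies in `B_0`. [folklore] -/
theorem pBall_subset_of_mem_truncHul {j : toyIndex.Label} {vQ : toyIndex.VQ} {H : Set (signShells.Packet j vQ)}
    (hH : H ∈ truncHul p K j vQ) : pBall p j vQ K ⊆ H ∧ H ⊆ pBall p j vQ 0 := by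
  obtain ⟨k, h0, hK, rfl⟩ := hH
  exact ⟨pBall_mono p j vQ hK, pBall_mono p j vQ h0⟩

/-- The intersection of the depth-`K` hull-sets containing a region `U ⊆ B_0` is the ball of LARGEST admissible index containing `U`, hence a
hull-set (well-definedness of the hull, Rmk. 3.9.5 (i)). [folklore] -/
theorem sInter_truncHul_mem {j : toyIndex.Label} {vQ : toyIndex.VQ} {U : Set (signShells.Packet j vQ)} (hU : U ⊆ pBall p j vQ 0) :
    (⋂₀ {H | H ∈ truncHul p K j vQ ∧ U ⊆ H}) ∈ truncHul p K j vQ := by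
  obtain ⟨m, ⟨hm0, hmK, hUm⟩, hmax⟩ :=
    Int.exists_greatest_of_bdd (P := fun k : ℤ => 0 ≤ k ∧ k ≤ K ∧ U ⊆ pBall p j vQ k) ⟨K, fun z hz => hz.2.1⟩ ⟨0, le_rfl, by positivity, hU⟩
  have hEq : (⋂₀ {H | H ∈ truncHul p K j vQ ∧ U ⊆ H}) = pBall p j vQ m := by
    refine Set.Subset.antisymm (Set.sInter_subset_of_mem ⟨⟨m, hm0, hmK, rfl⟩, hUm⟩) (Set.subset_sInter ?_)
    rintro H ⟨⟨k, hk0, hkK, rfl⟩, hUk⟩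
    exact pBall_mono p j vQ (hmax k ⟨hk0, hkK, hUk⟩)
  rw [hEq]; exact ⟨m, hm0, hmK, rfl⟩

/-- **The TRUNCATED `p`-adic hull frame of depth `K`**: hull-sets `{B_0, …, B_K}`; «relatively compact» := inside `B_0`; every such region
admits its hull. A toy of [IUTchIII] Rmk. 3.9.5 (i) whose hull INFLATES non-uniformly (`hull B_m = B_{min(m,K)}`). DATA of a toy.
[claim: Mochizuki2012, status: disputed] -/
def truncFrame (j : toyIndex.Label) (vQ : toyIndex.VQ) : HullFrame (signShells.Packet j vQ) where
  Hul := truncHul p K j vQ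
  IsBounded := fun U => U ⊆ pBall p j vQ 0
  HasHull := fun _ => True
  hul_bounded := fun _ hH => (pBall_subset_of_mem_truncHul p K hH).2
  bounded_mono := fun _ _ hUU' hU' => hUU'.trans hU'
  exists_hul := fun _ hU => ⟨pBall p j vQ 0, ⟨0, le_rfl, by positivity, rfl⟩, hU⟩
  hull_mem := fun _ h0 _ => sInter_truncHul_mem p K h0

variable [hp : Fact p.Prime]

/-- **Over the depth-`K` frame the hull of `B_m` (`m ≥ 0`) is `B_{min(m, K)}`.** [folklore] -/
theorem truncFrame_hull_pBall (j : toyIndex.Label) (vQ : toyIndex.VQ) {m : ℤ} (hm : 0 ≤ m) :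
    (truncFrame p K j vQ).hull (pBall p j vQ m) = pBall p j vQ (min m K) := by
  refine Set.Subset.antisymm
    ((truncFrame p K j vQ).hull_subset_of_mem (pBall_mem_truncHul p K j vQ (le_min hm (by positivity)) (min_le_right _ _))
      (pBall_mono p j vQ (min_le_left _ _))) ?_
  unfold HullFrame.hull
  rw [if_pos (show (truncFrame p K j vQ).IsBounded (pBall p j vQ m) from pBall_mono p j vQ hm)]
  refine Set.subset_sInter ?_
  rintro H ⟨⟨k, hk0, hkK, rfl⟩, hmk⟩
  exact pBall_mono p j vQ (le_min ((pBall_subset_iff p j vQ m k).1 hmk) hkK)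

/-! ## 2. PR-2's pinned setting over the truncated frame (every other field verbatim) -/

/-- **The depth-`K` setting** (`K ≥ 1`, so that the q-pilot image `B_1` is a hull-set, as c312-7's `qRegion_mem` demands): abc-iut-w4-d101's
`pinnedSetting p` with the field `frame` := the truncated frame — same lattice, monoids, pilot data and BOTH glue fields (the same honest
regions and volumes as CM and as the flip). DATA of a toy. [claim: Mochizuki2012, status: disputed] -/
def truncSetting (hK : 1 ≤ K) : Setting (naiveSituation p) :=
  { pinnedSetting p with
    frame := fun j vQ => truncFrame p K j vQ
    hul_adm := fun _ _ _ hH => by obtain ⟨k, -, -, rfl⟩ := hH; exact ⟨k, rfl⟩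
    qRegion_mem := fun j vQ => by
      show (pinnedSetting p).qRegion j vQ ∈ truncHul p K j vQ
      by_cases hj : j = 0
      · subst hj; rw [pinnedSetting_qRegion_zero]; exact ⟨0, le_rfl, by positivity, rfl⟩
      · rw [pinnedSetting_qRegion_of_ne_zero p hj]; exact ⟨1, zero_le_one, by exact_mod_cast hK, rfl⟩
    qSupport_finite := fun _ => Set.toFinite _ }

variable {K} (hK : 1 ≤ K)

omit hp in
/-- The glue fields, pilots and column of `truncSetting` ARE those of `pinnedSetting` (only the frame differs). [folklore] -/
theorem trunc_fields_eq : (truncSetting p K hK).thetaRegion = (pinnedSetting p).thetaRegion ∧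
    (truncSetting p K hK).qRegion = (pinnedSetting p).qRegion ∧ (truncSetting p K hK).n = (pinnedSetting p).n := ⟨rfl, rfl, rfl⟩

omit hp in
/-- The Kummer images of the Θ-pilot are CM's balls `B_{j²}`. [folklore] -/
theorem trunc_thetaRegion (m : ℤ) (j : toyIndex.Label) (vQ : toyIndex.VQ) :
    (truncSetting p K hK).thetaRegion m j vQ = pBall p j vQ (jsq j) := pinnedSetting_thetaRegion p m j vQ

omit hp in
/-- The possible images at `(j, v_ℚ)` are `{B_{j²}}`, as for `pinnedSetting`. [folklore] -/
theorem trunc_possibleImages (j : toyIndex.Label) (vQ : toyIndex.VQ) :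
    (truncSetting p K hK).possibleImages j vQ = {pBall p j vQ (jsq j)} := pinnedSetting_possibleImages p j vQ

omit hp in
/-- The union of the possible images is `B_{j²}`. [folklore] -/
theorem trunc_sUnion_possibleImages (j : toyIndex.Label) (vQ : toyIndex.VQ) :
    ⋃₀ (truncSetting p K hK).possibleImages j vQ = pBall p j vQ (jsq j) := by rw [trunc_possibleImages, Set.sUnion_singleton]

omit hp in
/-- Every union of possible images admits its hull over the truncated frame (`B_{j²} ⊆ B_0`). [folklore] -/
theorem trunc_hullDefined (j : toyIndex.Label) (vQ : toyIndex.VQ) : (truncSetting p K hK).HullDefined j vQ := by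
  refine ⟨?_, trivial⟩
  show ⋃₀ (truncSetting p K hK).possibleImages j vQ ⊆ pBall p j vQ 0
  rw [trunc_sUnion_possibleImages]
  exact pBall_mono p j vQ (by unfold jsq; positivity)

/-- **NON-UNIFORM INFLATION**: the hull of the union of the possible images at label `j` is `B_{min(j², K)}`. [folklore] -/
theorem trunc_thetaHull (j : toyIndex.Label) (vQ : toyIndex.VQ) :
    (truncSetting p K hK).thetaHull j vQ = pBall p j vQ (min (jsq j) K) := by
  unfold Setting.thetaHull
  rw [trunc_sUnion_possibleImages]
  exact truncFrame_hull_pBall p K j vQ (by unfold jsq; positivity)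

/-- The local Θ-term at label `j` is `−min(j², K)·log p`. [folklore] -/
theorem trunc_thetaLocal (j : toyIndex.Label) (vQ : toyIndex.VQ) :
    (truncSetting p K hK).thetaLocal j vQ = ((-((min (jsq j) K : ℤ) : ℝ) * Real.log p : ℝ) : WithTop ℝ) := by
  unfold Setting.thetaLocal
  rw [if_pos (trunc_hullDefined p hK j vQ), trunc_thetaHull]
  show ((pVol p j vQ (pBall p j vQ (min (jsq j) K)) : ℝ) : WithTop ℝ) = _
  rw [pVol_pBall]

/-- The own Θ-volume at label `j` is CM's `−j²·log p`. [folklore] -/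
theorem trunc_logvol_thetaRegion (m : ℤ) (j : toyIndex.Label) (vQ : toyIndex.VQ) :
    ((naiveSituation p).D (truncSetting p K hK).n).logvol j vQ ((truncSetting p K hK).thetaRegion m j vQ) = -(jsq j : ℝ) * Real.log p := by
  show pVol p j vQ ((truncSetting p K hK).thetaRegion m j vQ) = _
  rw [trunc_thetaRegion, pVol_pBall]

/-- "`−|log(Θ)|` is finite". [folklore] -/
theorem trunc_thetaFinite : (truncSetting p K hK).ThetaFinite :=
  ⟨fun i vQ => by rw [trunc_thetaLocal]; exact WithTop.coe_ne_top, fun _ => Set.toFinite _⟩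

/-- **`−|log(Θ)| = −((min(1,K) + min(4,K))/2)·log p`** (average over the labels `1, 2`). [folklore] -/
theorem trunc_negLogTheta :
    (truncSetting p K hK).negLogTheta = ((-(((min (1 : ℤ) K + min (4 : ℤ) K : ℤ) : ℝ) / 2) * Real.log p : ℝ) : WithTop ℝ) := by
  rw [(truncSetting p K hK).negLogTheta_eq_of_thetaFinite (trunc_thetaFinite p hK)]
  congr 1
  have h : (fun i : Fin toyIndex.lstar => ∑ᶠ vQ : toyIndex.VQ, ((truncSetting p K hK).thetaLocal (Setting.labelSucc i) vQ).untopD 0) =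
      fun i : Fin toyIndex.lstar => -((min (jsq (Setting.labelSucc i)) K : ℤ) : ℝ) * Real.log p := by
    funext i
    simp only [trunc_thetaLocal, finsum_unique, WithTop.untopD_coe]
  rw [h]
  show (∑ i : Fin 2, -((min (jsq (Setting.labelSucc i)) K : ℤ) : ℝ) * Real.log p) / ((2 : ℕ) : ℝ) = _
  rw [Fin.sum_univ_two]
  change (-((min (jsq (Setting.labelSucc (T := toyIndex) ⟨0, by decide⟩)) K : ℤ) : ℝ) * Real.log p +
    -((min (jsq (Setting.labelSucc (T := toyIndex) ⟨1, by decide⟩)) K : ℤ) : ℝ) * Real.log p) / ((2 : ℕ) : ℝ) = _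
  have hj1 : jsq (Setting.labelSucc (T := toyIndex) ⟨0, by decide⟩) = 1 := by decide
  have hj4 : jsq (Setting.labelSucc (T := toyIndex) ⟨1, by decide⟩) = 4 := by decide
  rw [hj1, hj4]
  push_cast
  ring

/-- `−|log(q)| = −log p` (q-side of `pinnedSetting`). [folklore] -/
theorem trunc_negLogQ : (truncSetting p K hK).negLogQ = -Real.log p := pinnedSetting_negLogQ p

/-- `|log(q)| > 0`. [folklore] -/
theorem trunc_absLogQPos : (truncSetting p K hK).AbsLogQPos := pinnedSetting_absLogQPos p

/-- **THE TYPED COROLLARY 3.12 AT DEPTH `K` HOLDS IFF `K ≤ 1`** (i.e. only at the flip): `−log p ≤ −((min(1,K)+min(4,K))/2)·log p ⟺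
min(1,K) + min(4,K) ≤ 2 ⟺ K ≤ 1`. [folklore] -/
theorem trunc_statement_iff : (truncSetting p K hK).Statement ↔ K ≤ 1 := by
  have hl := log_p_pos p
  rw [(truncSetting p K hK).statement_iff_real (trunc_negLogTheta p hK), trunc_negLogQ]
  constructor
  · intro h
    have h' : (((min (1 : ℤ) K + min (4 : ℤ) K : ℤ) : ℝ)) ≤ 2 := by nlinarith
    have h'' : (min (1 : ℤ) K + min (4 : ℤ) K : ℤ) ≤ 2 := by exact_mod_cast h'
    omega
  · intro h
    have h'' : (min (1 : ℤ) K + min (4 : ℤ) K : ℤ) ≤ 2 := by omega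
    have h' : (((min (1 : ℤ) K + min (4 : ℤ) K : ℤ) : ℝ)) ≤ 2 := by exact_mod_cast h''
    nlinarith

/-- **Every bridge hypothesis of abc-iut-c312-6 holds** (volume clauses as for `pinnedSetting`; hull-sets are balls, nonempty). [folklore] -/
theorem trunc_bridgeHyps : BridgeHyps (truncSetting p K hK) where
  mono := (pinnedSetting_bridgeHyps p).mono
  image_adm := (pinnedSetting_bridgeHyps p).image_adm
  image_fin := fun _ => Set.toFinite _
  hul_nonempty := fun j vQ _ hH => by
    obtain ⟨k, -, -, rfl⟩ := hH
    exact ⟨0, zero_mem_pBall p j vQ k⟩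
  theta_nonempty := (pinnedSetting_bridgeHyps p).theta_nonempty
  finite := trunc_thetaFinite p hK

omit hp in
/-- The Θ-regions are admissible (they are CM's). [folklore] -/
theorem trunc_thetaRegionsAdm : ThetaRegionsAdm (truncSetting p K hK) := fun m i vQ => pinSetting_thetaRegionsAdm p m i vQ

/-! ## 3. The SAME pins and operators as CM: `PinnedRegions3` holds, S fails, at every depth -/

/-- **The three pins HOLD at every depth for PR-2's honest operators** (`orbitRegion`, `qDatum`, the object-level link) — the pin predicates do
not read the frame. [claim: Mochizuki2012, status: disputed] -/
theorem trunc_pinnedRegions3 : PinnedRegions3 (naiveFull p).toLatticeSituation (truncSetting p K hK) (orbitRegion p) (qDatum p) :=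
  pinnedSetting_pinnedRegions3 p

/-- **S FAILS at every depth** (CM's regions: `B_1` is no ⟨Ind1∪Ind2⟩-translate of `B_4`). [folklore] -/
theorem trunc_not_pilotKummerIndRelated :
    ¬ PilotKummerIndRelated (naiveFull p).toLatticeSituation (truncSetting p K hK) (orbitRegion p) (qDatum p) :=
  pinnedSetting_not_pilotKummerIndRelated p

/-- `GapA3` FAILS at every depth. [folklore] -/
theorem trunc_not_gapA3 : ¬ GapA3 (naiveFull p).toLatticeSituation (truncSetting p K hK) (orbitRegion p) (qDatum p) := fun hgap =>
  pinnedSetting_qRegion_not_mem_possibleImages p () (hgap (trunc_pinnedRegions3 p hK) _ ())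

/-- **THE FRAME-DEPTH FAMILY, packaged**: at every depth `K ≥ 1` the typed Thm. 3.11, `MultiradialCompat`, the bridge hypotheses,
`|log(q)| > 0` and the three pins HOLD and S FAILS; the typed Corollary holds iff `K ≤ 1`. [folklore] -/
theorem trunc_family :
    (naiveFull p).Statement ∧ (naiveFull p).MultiradialCompat ∧ BridgeHyps (truncSetting p K hK) ∧ (truncSetting p K hK).AbsLogQPos ∧
      PinnedRegions3 (naiveFull p).toLatticeSituation (truncSetting p K hK) (orbitRegion p) (qDatum p) ∧
      ¬ PilotKummerIndRelated (naiveFull p).toLatticeSituation (truncSetting p K hK) (orbitRegion p) (qDatum p) ∧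
      ((truncSetting p K hK).Statement ↔ K ≤ 1) :=
  ⟨naiveFull_statement p, naive_multiradialCompat p, trunc_bridgeHyps p hK, trunc_absLogQPos p hK, trunc_pinnedRegions3 p hK,
    trunc_not_pilotKummerIndRelated p hK, trunc_statement_iff p hK⟩

end TruncFrame

end Summit.ABC.IUTFork.Cor312Vol

end
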